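import Summits.Ventures.LatticeQCDFlow.Exactness.IMHColdStartThawTime
import HarnessLib

/-!
# The cold start with an atom at the mode: the exact law of the EXIT time of flow-MCMC, and the run after the first
# exit is the equilibrium run conditioned to start off the mode

HONEST FRAMING: exact (Metropolis-corrected) sampling algorithms for lattice gauge theory;
figures of merit are autocorrelation/cost numbers at stated couplings and volumes; no
continuum-physics claim.

Venture `LatticeQCDFlow` (cell pub-lqcd), topic `Exactness`; FANOUT row 30 (lean-1, GEN-34).  NEW WORK of the
cell, general state space with measurable singletons.  GEN-33 (`Exactness/IMHColdStartThawTime`) computed, for the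
flow-MCMC chain `K = indepMH q w` started at a mode `x₀` of the normalised weight `w` (`A = 1/w(x₀)`, `r = 1 − A`)
and a proposal WITHOUT AN ATOM at `x₀`, the joint law of the thaw time and the thawed run:
`P_{x₀}(X_0 = … = X_t = x₀, X_{t+1} ≠ x₀, X_{t+1+·} ∈ E) = A r^t·P_π(E)`.  For a FINITE gauge group the Haar
proposal has an atom at the cold configuration (`q{x₀} > 0`, `π{x₀} = w(x₀)q{x₀} > 0`): an accepted proposal may
BE the cold configuration, and the recorded stream cannot tell that acceptance from a rejection.  This file removes
the atom-free hypothesis — the event is now the first EXIT from `x₀`: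

* §1 **`chain_inter_eval_zero_singleton`** — for every Markov kernel, probability law `μ₀` and measurable set of
  paths `S`: `P_{μ₀}(S ∩ {X_0 = x₀}) = μ₀{x₀}·P_{x₀}(S)` (the chain from `μ₀`, on the atom of its start, is the chain
  from the point — the time-`0` disintegration, elementary through the mixture `μ₀ = μ₀{x₀}·δ_{x₀} + μ₀|_{≠x₀}`);
* §2 **`imh_chain_exitAt_inter_shift`** — THE JOINT LAW OF THE EXIT TIME AND THE RUN AFTER IT, WITH AN ATOM:
  `P_{x₀}(X_0 = … = X_t = x₀, X_{t+1} ≠ x₀, X_{t+1+·} ∈ E) = A·ρ^t·P_π(E ∩ {X_0 ≠ x₀})` EXACTLY, with the EXIT RATE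
  `1 − ρ = A·(1 − π{x₀})` (`ρ = r + A·π{x₀}`: stay by rejection, or by accepting a proposal equal to the mode) — by
  one thaw step (GEN-33 `imh_chain_thaw_step`) and §1, the exit event at `t + 1` being the `pad_1`-image of the exit
  event at `t`;
* §3 consequences: **`imh_chain_exitAt`** — THE EXIT TIME IS GEOMETRIC with success probability `A(1 − π{x₀})`
  (mean `w(x₀)/(1 − π{x₀})`); **`imh_chain_firstExit`** — THE FIRST CONFIGURATION OFF THE MODE IS AN EXACT DRAW FROM
  `π(· ∖ {x₀})` up to the factor `A ρ^t`: `P(T = t+1, X_T ∈ B) = A ρ^t·π(B ∖ {x₀})`; **`imh_chain_exitedRun`** —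
  summed over the exit time, `P_{x₀}(⋃_t {…, X_{t+1+·} ∈ E}) = P_π(E ∩ {X_0 ≠ x₀})/(1 − π{x₀})` (`π{x₀} < 1`): THE
  RUN RECORDED FROM THE FIRST EXIT IS, IN LAW, THE EQUILIBRIUM RUN CONDITIONED TO START OFF THE MODE; and
  **`imh_chain_exits`** — for `π{x₀} < 1` the chain leaves the mode almost surely;
(With `q{x₀} = 0`: `ρ = r`, `P_π(X_0 ≠ x₀) = 1`, and §2 is GEN-33's thaw law.)

Reading (finite gauge groups): «discard until the chain first LEAVES the cold configuration» removes the cold start up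
to the conditioning `X_0 ≠ cold`, at expected cost `w(cold)/(1 − π{cold})`.  NOT CLAIMED: non-modal starts; accept bits.

No `sorry`, no new definitions, nothing cited as a fact; general measurable space with measurable singletons.
-/

noncomputable section

namespace Summit.Ventures.LatticeQCDFlow.Exactness

open MeasureTheory ProbabilityTheory Function
open scoped ENNReal
open Summit.Ventures.LatticeQCDFlow.Scoring

variable {Ω : Type*} [MeasurableSpace Ω] [MeasurableSingletonClass Ω]

/-! ## §1 The chain from `μ₀` on the atom of its start is the chain from the point -/

/-- The chain from a probability law with no mass at `x₀` gives no mass to `{X_0 = x₀}`. [ours, bookkeeping] -/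
theorem chain_eval_zero_singleton_null (κ : Kernel Ω Ω) [IsMarkovKernel κ] (μ₀ : Measure Ω) [IsProbabilityMeasure μ₀]
    {x₀ : Ω} (h0 : μ₀ {x₀} = 0) :
    Kernel.trajMeasure (X := fun _ : ℕ => Ω) μ₀
        (fun n : ℕ => κ.comap (fun h : (i : ↥(Finset.Iic n)) → Ω => h ⟨n, Finset.mem_Iic.2 le_rfl⟩)
          (measurable_pi_apply _)) {x : ℕ → Ω | x 0 = x₀} = 0 := by
  rw [show {x : ℕ → Ω | x 0 = x₀} = (fun x : ℕ → Ω => x 0) ⁻¹' {x₀} from rfl,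
    ← Measure.map_apply (measurable_pi_apply 0) (measurableSet_singleton x₀), chain_map_eval_zero κ μ₀, h0]

/-- **THE TIME-`0` DISINTEGRATION ON AN ATOM**: for every Markov kernel, probability law `μ₀`, point `x₀` and measurable
set of paths `S` (measurable or not): `P_{μ₀}(S ∩ {X_0 = x₀}) = μ₀{x₀}·P_{x₀}(S)`. [ours] -/
theorem chain_inter_eval_zero_singleton (κ : Kernel Ω Ω) [IsMarkovKernel κ] (μ₀ : Measure Ω) [IsProbabilityMeasure μ₀]
    (x₀ : Ω) (S : Set (ℕ → Ω)) :
    Kernel.trajMeasure (X := fun _ : ℕ => Ω) μ₀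
        (fun n : ℕ => κ.comap (fun h : (i : ↥(Finset.Iic n)) → Ω => h ⟨n, Finset.mem_Iic.2 le_rfl⟩)
          (measurable_pi_apply _)) (S ∩ {x : ℕ → Ω | x 0 = x₀}) =
      μ₀ {x₀} * Kernel.trajMeasure (X := fun _ : ℕ => Ω) (Measure.dirac x₀)
        (fun n : ℕ => κ.comap (fun h : (i : ↥(Finset.Iic n)) → Ω => h ⟨n, Finset.mem_Iic.2 le_rfl⟩)
          (measurable_pi_apply _)) S := by
  -- from the point: `{X_0 = x₀}` is almost sure
  have hdirac : Kernel.trajMeasure (X := fun _ : ℕ => Ω) (Measure.dirac x₀)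
        (fun n : ℕ => κ.comap (fun h : (i : ↥(Finset.Iic n)) → Ω => h ⟨n, Finset.mem_Iic.2 le_rfl⟩)
          (measurable_pi_apply _)) (S ∩ {x : ℕ → Ω | x 0 = x₀}) =
      Kernel.trajMeasure (X := fun _ : ℕ => Ω) (Measure.dirac x₀)
        (fun n : ℕ => κ.comap (fun h : (i : ↥(Finset.Iic n)) → Ω => h ⟨n, Finset.mem_Iic.2 le_rfl⟩)
          (measurable_pi_apply _)) S := by
    refine measure_inter_conull ?_
    rw [show {x : ℕ → Ω | x 0 = x₀}ᶜ = (fun x : ℕ → Ω => x 0) ⁻¹' ({x₀}ᶜ) by ext x; simp,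
      ← Measure.map_apply (measurable_pi_apply 0) (measurableSet_singleton x₀).compl,
      chain_map_eval_zero κ (Measure.dirac x₀), Measure.dirac_apply' x₀ (measurableSet_singleton x₀).compl]
    simp
  set p : ℝ≥0∞ := μ₀ {x₀} with hp
  have hdec0 : μ₀ = p • Measure.dirac x₀ + μ₀.restrict {x₀}ᶜ := by
    rw [hp, ← Measure.restrict_singleton, Measure.restrict_add_restrict_compl (measurableSet_singleton x₀)]
  have hrest : μ₀.restrict {x₀}ᶜ Set.univ = 1 - p := by
    rw [Measure.restrict_apply MeasurableSet.univ, Set.univ_inter, measure_compl (measurableSet_singleton x₀)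
      (measure_ne_top _ _), measure_univ]
  by_cases hp1 : p = 1
  · -- all the mass sits at `x₀`: `μ₀ = δ_{x₀}`
    have hzero : μ₀.restrict {x₀}ᶜ = 0 := by
      rw [← Measure.measure_univ_eq_zero, hrest, hp1, tsub_self]
    have hμ : μ₀ = Measure.dirac x₀ := by
      rw [hdec0, hzero, add_zero, hp1, one_smul]
    rw [hμ, hp1, one_mul, hdirac]
  · -- `p < 1`: `μ₀ = p·δ_{x₀} + (1 − p)·ν̄` with `ν̄ = (1 − p)⁻¹·μ₀|_{≠x₀}` a probability law without mass at `x₀`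
    have hple : p ≤ 1 := hp ▸ prob_le_one
    have hplt : p < 1 := lt_of_le_of_ne hple hp1
    have h1p : 1 - p ≠ 0 := (tsub_pos_of_lt hplt).ne'
    have h1pt : 1 - p ≠ ⊤ := ne_top_of_le_ne_top ENNReal.one_ne_top tsub_le_self
    set ν : Measure Ω := (1 - p)⁻¹ • μ₀.restrict {x₀}ᶜ with hν
    haveI : IsProbabilityMeasure ν := ⟨by
      rw [hν, Measure.smul_apply, smul_eq_mul, hrest, ENNReal.inv_mul_cancel h1p h1pt]⟩
    have hν0 : ν {x₀} = 0 := by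
      rw [hν, Measure.smul_apply, smul_eq_mul, Measure.restrict_apply (measurableSet_singleton x₀),
        Set.inter_compl_self, measure_empty, mul_zero]
    have hdec : μ₀ = p • Measure.dirac x₀ + (1 - p) • ν := by
      rw [hν, smul_smul, ENNReal.mul_inv_cancel h1p h1pt, one_smul]; exact hdec0
    rw [hdec, chain_add_smul, Measure.add_apply, Measure.smul_apply, Measure.smul_apply, smul_eq_mul, smul_eq_mul,
      hdirac, measure_mono_null Set.inter_subset_right (chain_eval_zero_singleton_null κ ν hν0), mul_zero,
      add_zero]

/-! ## §2 The exit event: one thaw step and the recursion -/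

omit [MeasurableSpace Ω] [MeasurableSingletonClass Ω] in
/-- `pad_1⁻¹` of the exit event at time `1`: `{y_0 ≠ x₀} ∩ E`. [ours, bookkeeping] -/
theorem padOne_preimage_exitAt_zero (x₀ : Ω) (E : Set (ℕ → Ω)) :
    (fun (y : ℕ → Ω) (n : ℕ) => if n < 1 then x₀ else y (n - 1)) ⁻¹' {x : ℕ → Ω | (∀ i, i ≤ 0 → x i = x₀) ∧ x (0 + 1) ≠ x₀ ∧ (fun n => x (0 + 1 + n)) ∈ E} =
      E ∩ {y : ℕ → Ω | y 0 ≠ x₀} := by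
  ext y
  simp only [Set.mem_preimage, Set.mem_setOf_eq, Set.mem_inter_iff, zero_add, lt_irrefl, if_false, Nat.sub_self]
  have h3 : (fun n => if 1 + n < 1 then x₀ else y (1 + n - 1)) = y := by
    funext n
    rw [if_neg (by omega), Nat.add_sub_cancel_left]
  rw [h3]
  constructor
  · rintro ⟨-, h2, h4⟩; exact ⟨h4, h2⟩
  · rintro ⟨h4, h2⟩; exact ⟨fun i hi => by rw [if_pos (by omega)], h2, h4⟩

omit [MeasurableSpace Ω] [MeasurableSingletonClass Ω] in
/-- `pad_1⁻¹` of the exit event at time `t + 2` is the exit event at time `t + 1`. [ours, bookkeeping] -/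
theorem padOne_preimage_exitAt_succ (x₀ : Ω) (t : ℕ) (E : Set (ℕ → Ω)) :
    (fun (y : ℕ → Ω) (n : ℕ) => if n < 1 then x₀ else y (n - 1)) ⁻¹' {x : ℕ → Ω | (∀ i, i ≤ (t + 1) → x i = x₀) ∧ x ((t + 1) + 1) ≠ x₀ ∧ (fun n => x ((t + 1) + 1 + n)) ∈ E} =
      {x : ℕ → Ω | (∀ i, i ≤ t → x i = x₀) ∧ x (t + 1) ≠ x₀ ∧ (fun n => x (t + 1 + n)) ∈ E} := by
  ext y
  simp only [Set.mem_preimage, Set.mem_setOf_eq]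
  have hsh : (fun n => if t + 1 + 1 + n < 1 then x₀ else y (t + 1 + 1 + n - 1)) = fun n => y (t + 1 + n) := by
    funext n
    rw [if_neg (by omega)]
    congr 1
    omega
  rw [hsh, if_neg (by omega), show t + 1 + 1 - 1 = t + 1 by omega]
  constructor
  · rintro ⟨h1, h2, h3⟩
    refine ⟨fun i hi => ?_, h2, h3⟩
    have h := h1 (i + 1) (by omega)
    rwa [if_neg (by omega), Nat.add_sub_cancel] at h
  · rintro ⟨h1, h2, h3⟩
    refine ⟨fun i hi => ?_, h2, h3⟩
    by_cases hi0 : i < 1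
    · rw [if_pos hi0]
    · rw [if_neg hi0]
      exact h1 (i - 1) (by omega)

omit [MeasurableSpace Ω] [MeasurableSingletonClass Ω] in
/-- The exit event lies in `{X_0 = x₀}`. [ours, bookkeeping] -/
theorem exitAt_inter_eval_zero (x₀ : Ω) (t : ℕ) (E : Set (ℕ → Ω)) :
    {x : ℕ → Ω | (∀ i, i ≤ t → x i = x₀) ∧ x (t + 1) ≠ x₀ ∧ (fun n => x (t + 1 + n)) ∈ E} ∩ {x : ℕ → Ω | x 0 = x₀} = {x : ℕ → Ω | (∀ i, i ≤ t → x i = x₀) ∧ x (t + 1) ≠ x₀ ∧ (fun n => x (t + 1 + n)) ∈ E} := by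
  ext x
  simp only [Set.mem_inter_iff, Set.mem_setOf_eq]
  constructor
  · rintro ⟨h, -⟩; exact h
  · intro h; exact ⟨h, h.1 0 (Nat.zero_le _)⟩

variable {q : Measure Ω} [IsProbabilityMeasure q] {w : Ω → ℝ}

/-- **The equilibrium run on the exit event**: `P_π(exit event at t+1) = π{x₀}·P_{x₀}(exit event at t+1)` (§1).
[ours] -/
theorem imh_chain_stationary_exitAt [Fact (Measurable w)] (x₀ : Ω)
    [IsProbabilityMeasure (q.withDensity fun y => ENNReal.ofReal (w y))] (t : ℕ) (E : Set (ℕ → Ω)) :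
    Kernel.trajMeasure (X := fun _ : ℕ => Ω) (q.withDensity fun y => ENNReal.ofReal (w y))
        (fun n : ℕ => (indepMH q w).comap (fun h : (i : ↥(Finset.Iic n)) → Ω => h ⟨n, Finset.mem_Iic.2 le_rfl⟩)
          (measurable_pi_apply _)) {x : ℕ → Ω | (∀ i, i ≤ t → x i = x₀) ∧ x (t + 1) ≠ x₀ ∧ (fun n => x (t + 1 + n)) ∈ E} =
      (q.withDensity fun y => ENNReal.ofReal (w y)) {x₀} * Kernel.trajMeasure (X := fun _ : ℕ => Ω) (Measure.dirac x₀)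
        (fun n : ℕ => (indepMH q w).comap (fun h : (i : ↥(Finset.Iic n)) → Ω => h ⟨n, Finset.mem_Iic.2 le_rfl⟩)
          (measurable_pi_apply _)) {x : ℕ → Ω | (∀ i, i ≤ t → x i = x₀) ∧ x (t + 1) ≠ x₀ ∧ (fun n => x (t + 1 + n)) ∈ E} := by
  rw [← exitAt_inter_eval_zero x₀ t E]
  rw [chain_inter_eval_zero_singleton (indepMH q w) _ x₀, exitAt_inter_eval_zero]

/-- **THE FIRST STEP**: `P_{x₀}(X_1 ≠ x₀, X_{1+·} ∈ E) = A·P_π(E ∩ {X_0 ≠ x₀})` (one thaw step; the frozen branch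
cannot leave). [ours] -/
theorem imh_chain_exitAt_zero [Fact (Measurable w)] (hw0 : ∀ y, 0 < w y) {x₀ : Ω} (hmax : ∀ y, w y ≤ w x₀)
    [IsProbabilityMeasure (q.withDensity fun y => ENNReal.ofReal (w y))] {E : Set (ℕ → Ω)} (hE : MeasurableSet E) :
    Kernel.trajMeasure (X := fun _ : ℕ => Ω) (Measure.dirac x₀)
        (fun n : ℕ => (indepMH q w).comap (fun h : (i : ↥(Finset.Iic n)) → Ω => h ⟨n, Finset.mem_Iic.2 le_rfl⟩)
          (measurable_pi_apply _)) {x : ℕ → Ω | (∀ i, i ≤ 0 → x i = x₀) ∧ x (0 + 1) ≠ x₀ ∧ (fun n => x (0 + 1 + n)) ∈ E} =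
      ENNReal.ofReal (w x₀)⁻¹ * Kernel.trajMeasure (X := fun _ : ℕ => Ω) (q.withDensity fun y => ENNReal.ofReal (w y))
        (fun n : ℕ => (indepMH q w).comap (fun h : (i : ↥(Finset.Iic n)) → Ω => h ⟨n, Finset.mem_Iic.2 le_rfl⟩)
          (measurable_pi_apply _)) (E ∩ {y : ℕ → Ω | y 0 ≠ x₀}) := by
  have hS := measurableSet_thawAt x₀ 0 hE
  have hnull : Kernel.trajMeasure (X := fun _ : ℕ => Ω) (Measure.dirac x₀)
        (fun n : ℕ => (indepMH q w).comap (fun h : (i : ↥(Finset.Iic n)) → Ω => h ⟨n, Finset.mem_Iic.2 le_rfl⟩)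
          (measurable_pi_apply _)) (E ∩ {y : ℕ → Ω | y 0 ≠ x₀}) = 0 := by
    refine measure_mono_null Set.inter_subset_right ?_
    rw [show {y : ℕ → Ω | y 0 ≠ x₀} = (fun x : ℕ → Ω => x 0) ⁻¹' ({x₀}ᶜ) by ext x; simp,
      ← Measure.map_apply (measurable_pi_apply 0) (measurableSet_singleton x₀).compl,
      chain_map_eval_zero (indepMH q w) (Measure.dirac x₀), Measure.dirac_apply' x₀ (measurableSet_singleton x₀).compl]
    simp
  conv_lhs => rw [imh_chain_thaw_step hw0 hmax]
  rw [Measure.add_apply, Measure.smul_apply, Measure.smul_apply, smul_eq_mul, smul_eq_mul,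
    Measure.map_apply (measurable_pad x₀ 1) hS, Measure.map_apply (measurable_pad x₀ 1) hS,
    padOne_preimage_exitAt_zero, hnull, mul_zero, add_zero]

/-- **THE RECURSION**: `P_{x₀}(exit at t+2, …) = (A·π{x₀} + r)·P_{x₀}(exit at t+1, …)` — one thaw step: the fresh
equilibrium branch realises the later exit event only by STARTING on the atom (§1), the frozen branch shifts it.
[ours] -/
theorem imh_chain_exitAt_succ [Fact (Measurable w)] (hw0 : ∀ y, 0 < w y) {x₀ : Ω} (hmax : ∀ y, w y ≤ w x₀)
    [IsProbabilityMeasure (q.withDensity fun y => ENNReal.ofReal (w y))] (t : ℕ) {E : Set (ℕ → Ω)}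
    (hE : MeasurableSet E) :
    Kernel.trajMeasure (X := fun _ : ℕ => Ω) (Measure.dirac x₀)
        (fun n : ℕ => (indepMH q w).comap (fun h : (i : ↥(Finset.Iic n)) → Ω => h ⟨n, Finset.mem_Iic.2 le_rfl⟩)
          (measurable_pi_apply _)) {x : ℕ → Ω | (∀ i, i ≤ (t + 1) → x i = x₀) ∧ x ((t + 1) + 1) ≠ x₀ ∧ (fun n => x ((t + 1) + 1 + n)) ∈ E} =
      (ENNReal.ofReal (w x₀)⁻¹ * (q.withDensity fun y => ENNReal.ofReal (w y)) {x₀} + ENNReal.ofReal (1 - (w x₀)⁻¹)) *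
        Kernel.trajMeasure (X := fun _ : ℕ => Ω) (Measure.dirac x₀)
        (fun n : ℕ => (indepMH q w).comap (fun h : (i : ↥(Finset.Iic n)) → Ω => h ⟨n, Finset.mem_Iic.2 le_rfl⟩)
          (measurable_pi_apply _)) {x : ℕ → Ω | (∀ i, i ≤ t → x i = x₀) ∧ x (t + 1) ≠ x₀ ∧ (fun n => x (t + 1 + n)) ∈ E} := by
  have hS := measurableSet_thawAt x₀ (t + 1) hE
  conv_lhs => rw [imh_chain_thaw_step hw0 hmax]
  rw [Measure.add_apply, Measure.smul_apply, Measure.smul_apply, smul_eq_mul, smul_eq_mul,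
    Measure.map_apply (measurable_pad x₀ 1) hS, Measure.map_apply (measurable_pad x₀ 1) hS,
    padOne_preimage_exitAt_succ, imh_chain_stationary_exitAt x₀ t E, add_mul, mul_assoc]

/-- **THE JOINT LAW OF THE EXIT TIME AND THE RUN AFTER IT, WITH AN ATOM AT THE MODE.**  `w` measurable (a `Fact`),
positive, normalised, maximal at `x₀`; `A = 1/w(x₀)`; EXIT RATE `1 − ρ`, `ρ = 1 − A·(1 − π{x₀})`.  For every `t` and every
measurable set of paths `E`:
`P_{x₀}(X_0 = … = X_t = x₀, X_{t+1} ≠ x₀, X_{t+1+·} ∈ E) = A·ρ^t·P_π(E ∩ {X_0 ≠ x₀})`. [ours] -/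
theorem imh_chain_exitAt_inter_shift [Fact (Measurable w)] (hw0 : ∀ y, 0 < w y) {x₀ : Ω} (hmax : ∀ y, w y ≤ w x₀)
    [IsProbabilityMeasure (q.withDensity fun y => ENNReal.ofReal (w y))] (t : ℕ) {E : Set (ℕ → Ω)}
    (hE : MeasurableSet E) :
    Kernel.trajMeasure (X := fun _ : ℕ => Ω) (Measure.dirac x₀)
        (fun n : ℕ => (indepMH q w).comap (fun h : (i : ↥(Finset.Iic n)) → Ω => h ⟨n, Finset.mem_Iic.2 le_rfl⟩)
          (measurable_pi_apply _)) {x : ℕ → Ω | (∀ i, i ≤ t → x i = x₀) ∧ x (t + 1) ≠ x₀ ∧ (fun n => x (t + 1 + n)) ∈ E} =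
      ENNReal.ofReal ((w x₀)⁻¹ *
          (1 - (w x₀)⁻¹ * (1 - (q.withDensity fun y => ENNReal.ofReal (w y)).real {x₀})) ^ t) *
        Kernel.trajMeasure (X := fun _ : ℕ => Ω) (q.withDensity fun y => ENNReal.ofReal (w y))
        (fun n : ℕ => (indepMH q w).comap (fun h : (i : ↥(Finset.Iic n)) → Ω => h ⟨n, Finset.mem_Iic.2 le_rfl⟩)
          (measurable_pi_apply _)) (E ∩ {y : ℕ → Ω | y 0 ≠ x₀}) := by
  set π : Measure Ω := q.withDensity fun y => ENNReal.ofReal (w y) with hπ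
  have hW : 1 ≤ w x₀ := one_le_of_mode (q := q) hmax
  have hA0 : 0 ≤ (w x₀)⁻¹ := inv_nonneg.mpr (hw0 x₀).le
  have hr0 : 0 ≤ 1 - (w x₀)⁻¹ := sub_nonneg.2 (inv_le_one_of_one_le₀ hW)
  have hρ : ENNReal.ofReal (w x₀)⁻¹ * π {x₀} + ENNReal.ofReal (1 - (w x₀)⁻¹) =
      ENNReal.ofReal (1 - (w x₀)⁻¹ * (1 - π.real {x₀})) := by
    rw [show π {x₀} = ENNReal.ofReal (π.real {x₀}) by rw [ofReal_measureReal (measure_ne_top _ _)],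
      ← ENNReal.ofReal_mul hA0, ← ENNReal.ofReal_add (mul_nonneg hA0 measureReal_nonneg) hr0]
    congr 1
    ring
  have hρ0 : 0 ≤ 1 - (w x₀)⁻¹ * (1 - π.real {x₀}) := by
    have : (w x₀)⁻¹ * (1 - π.real {x₀}) ≤ 1 * 1 :=
      mul_le_mul (inv_le_one_of_one_le₀ hW) (sub_le_self _ measureReal_nonneg) (sub_nonneg.2 measureReal_le_one)
        zero_le_one
    linarith
  induction t with
  | zero => rw [pow_zero, mul_one]; exact imh_chain_exitAt_zero hw0 hmax hE
  | succ t ih =>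
    rw [imh_chain_exitAt_succ hw0 hmax t hE, ih, hρ, ← mul_assoc, ← ENNReal.ofReal_mul hρ0]
    congr 2
    ring

/-! ## §3 The exit time, the first configuration off the mode, the run after the exit -/

/-- **THE EXIT TIME IS GEOMETRIC WITH SUCCESS PROBABILITY `A(1 − π{x₀})`**:
`P_{x₀}(X_0 = … = X_t = x₀, X_{t+1} ≠ x₀) = A·ρ^t·(1 − π{x₀})`. [ours] -/
theorem imh_chain_exitAt [Fact (Measurable w)] (hw0 : ∀ y, 0 < w y) {x₀ : Ω} (hmax : ∀ y, w y ≤ w x₀)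
    [IsProbabilityMeasure (q.withDensity fun y => ENNReal.ofReal (w y))] (t : ℕ) :
    (Kernel.trajMeasure (X := fun _ : ℕ => Ω) (Measure.dirac x₀)
        (fun n : ℕ => (indepMH q w).comap (fun h : (i : ↥(Finset.Iic n)) → Ω => h ⟨n, Finset.mem_Iic.2 le_rfl⟩)
          (measurable_pi_apply _))).real {x : ℕ → Ω | (∀ i, i ≤ t → x i = x₀) ∧ x (t + 1) ≠ x₀} =
      (w x₀)⁻¹ * (1 - (w x₀)⁻¹ * (1 - (q.withDensity fun y => ENNReal.ofReal (w y)).real {x₀})) ^ t *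
        (1 - (q.withDensity fun y => ENNReal.ofReal (w y)).real {x₀}) := by
  set π : Measure Ω := q.withDensity fun y => ENNReal.ofReal (w y) with hπ
  have hW : 1 ≤ w x₀ := one_le_of_mode (q := q) hmax
  have hA0 : 0 ≤ (w x₀)⁻¹ := inv_nonneg.mpr (hw0 x₀).le
  have hρ0 : 0 ≤ 1 - (w x₀)⁻¹ * (1 - π.real {x₀}) := by
    have : (w x₀)⁻¹ * (1 - π.real {x₀}) ≤ 1 * 1 :=
      mul_le_mul (inv_le_one_of_one_le₀ hW) (sub_le_self _ measureReal_nonneg) (sub_nonneg.2 measureReal_le_one)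
        zero_le_one
    linarith
  have h := imh_chain_exitAt_inter_shift (q := q) hw0 hmax t MeasurableSet.univ (x₀ := x₀)
  simp only [Set.mem_univ, and_true, Set.univ_inter] at h
  have hc : (Kernel.trajMeasure (X := fun _ : ℕ => Ω) (q.withDensity fun y => ENNReal.ofReal (w y))
        (fun n : ℕ => (indepMH q w).comap (fun h : (i : ↥(Finset.Iic n)) → Ω => h ⟨n, Finset.mem_Iic.2 le_rfl⟩)
          (measurable_pi_apply _))).real {y : ℕ → Ω | y 0 ≠ x₀} = 1 - π.real {x₀} := by
    rw [show {y : ℕ → Ω | y 0 ≠ x₀} = (fun x : ℕ → Ω => x 0) ⁻¹' ({x₀}ᶜ) by ext x; simp,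
      ← map_measureReal_apply (measurable_pi_apply 0) (measurableSet_singleton x₀).compl,
      chain_map_eval_zero (indepMH q w) π, measureReal_compl (measurableSet_singleton x₀), probReal_univ]
  rw [measureReal_def, h, ENNReal.toReal_mul, ENNReal.toReal_ofReal (mul_nonneg hA0 (pow_nonneg hρ0 t)),
    ← measureReal_def, hc]

/-- **THE FIRST CONFIGURATION OFF THE MODE**: `P_{x₀}(X_0 = … = X_t = x₀, X_{t+1} ≠ x₀, X_{t+1} ∈ B) = A·ρ^t·π(B ∖ {x₀})`
— up to the geometric factor an exact draw from the target restricted off the mode. [ours] -/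
theorem imh_chain_firstExit [Fact (Measurable w)] (hw0 : ∀ y, 0 < w y) {x₀ : Ω} (hmax : ∀ y, w y ≤ w x₀)
    [IsProbabilityMeasure (q.withDensity fun y => ENNReal.ofReal (w y))] (t : ℕ) {B : Set Ω} (hB : MeasurableSet B) :
    Kernel.trajMeasure (X := fun _ : ℕ => Ω) (Measure.dirac x₀)
        (fun n : ℕ => (indepMH q w).comap (fun h : (i : ↥(Finset.Iic n)) → Ω => h ⟨n, Finset.mem_Iic.2 le_rfl⟩)
          (measurable_pi_apply _)) {x : ℕ → Ω | (∀ i, i ≤ t → x i = x₀) ∧ x (t + 1) ≠ x₀ ∧ x (t + 1) ∈ B} =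
      ENNReal.ofReal ((w x₀)⁻¹ *
          (1 - (w x₀)⁻¹ * (1 - (q.withDensity fun y => ENNReal.ofReal (w y)).real {x₀})) ^ t) *
        (q.withDensity fun y => ENNReal.ofReal (w y)) (B \ {x₀}) := by
  have hE : MeasurableSet {y : ℕ → Ω | y 0 ∈ B} := (measurable_pi_apply 0) hB
  have h := imh_chain_exitAt_inter_shift (q := q) hw0 hmax t hE (x₀ := x₀)
  have hset : {y : ℕ → Ω | y 0 ∈ B} ∩ {y : ℕ → Ω | y 0 ≠ x₀} = (fun x : ℕ → Ω => x 0) ⁻¹' (B \ {x₀}) := by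
    ext y; simp
  rw [hset, ← Measure.map_apply (measurable_pi_apply 0) (hB.diff (measurableSet_singleton x₀)),
    chain_map_eval_zero (indepMH q w)] at h
  rw [← h]
  rfl

omit [MeasurableSingletonClass Ω] in
/-- `Σ_t A ρ^t = 1/(1 − π{x₀})` when `π{x₀} < 1` (`1 − ρ = A(1 − π{x₀})`). [ours, bookkeeping] -/
theorem hasSum_exit_weights (hw0 : ∀ y, 0 < w y) {x₀ : Ω} (hmax : ∀ y, w y ≤ w x₀)
    [IsProbabilityMeasure (q.withDensity fun y => ENNReal.ofReal (w y))]
    (hπ0 : (q.withDensity fun y => ENNReal.ofReal (w y)).real {x₀} < 1) :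
    HasSum (fun t : ℕ => (w x₀)⁻¹ *
        (1 - (w x₀)⁻¹ * (1 - (q.withDensity fun y => ENNReal.ofReal (w y)).real {x₀})) ^ t)
      (1 - (q.withDensity fun y => ENNReal.ofReal (w y)).real {x₀})⁻¹ := by
  set π : Measure Ω := q.withDensity fun y => ENNReal.ofReal (w y) with hπ
  have hA0 : 0 < (w x₀)⁻¹ := inv_pos.mpr (hw0 x₀)
  have hW : 1 ≤ w x₀ := one_le_of_mode (q := q) hmax
  have h1π : 0 < 1 - π.real {x₀} := sub_pos.2 hπ0
  have hρ0 : 0 ≤ 1 - (w x₀)⁻¹ * (1 - π.real {x₀}) := by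
    have : (w x₀)⁻¹ * (1 - π.real {x₀}) ≤ 1 * 1 :=
      mul_le_mul (inv_le_one_of_one_le₀ hW) (sub_le_self _ measureReal_nonneg) h1π.le zero_le_one
    linarith
  have hρ1 : 1 - (w x₀)⁻¹ * (1 - π.real {x₀}) < 1 := sub_lt_self _ (mul_pos hA0 h1π)
  have h := (hasSum_geometric_of_lt_one hρ0 hρ1).mul_left (w x₀)⁻¹
  rw [sub_sub_cancel, mul_inv, ← mul_assoc, mul_inv_cancel₀ hA0.ne', one_mul] at h
  exact h

/-- **THE RUN AFTER THE FIRST EXIT IS THE EQUILIBRIUM RUN CONDITIONED TO START OFF THE MODE**: for `π{x₀} < 1` and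
every measurable set of paths `E`,
`P_{x₀}(⋃_t {X_0 = … = X_t = x₀, X_{t+1} ≠ x₀, X_{t+1+·} ∈ E}) = P_π(E ∩ {X_0 ≠ x₀})/(1 − π{x₀}) = P_π(E ∣ X_0 ≠ x₀)`.
[ours] -/
theorem imh_chain_exitedRun [Fact (Measurable w)] (hw0 : ∀ y, 0 < w y) {x₀ : Ω} (hmax : ∀ y, w y ≤ w x₀)
    [IsProbabilityMeasure (q.withDensity fun y => ENNReal.ofReal (w y))]
    (hπ0 : (q.withDensity fun y => ENNReal.ofReal (w y)).real {x₀} < 1) {E : Set (ℕ → Ω)} (hE : MeasurableSet E) :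
    Kernel.trajMeasure (X := fun _ : ℕ => Ω) (Measure.dirac x₀)
        (fun n : ℕ => (indepMH q w).comap (fun h : (i : ↥(Finset.Iic n)) → Ω => h ⟨n, Finset.mem_Iic.2 le_rfl⟩)
          (measurable_pi_apply _)) (⋃ t : ℕ, {x : ℕ → Ω | (∀ i, i ≤ t → x i = x₀) ∧ x (t + 1) ≠ x₀ ∧ (fun n => x (t + 1 + n)) ∈ E}) =
      ENNReal.ofReal (1 - (q.withDensity fun y => ENNReal.ofReal (w y)).real {x₀})⁻¹ *
        Kernel.trajMeasure (X := fun _ : ℕ => Ω) (q.withDensity fun y => ENNReal.ofReal (w y))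
        (fun n : ℕ => (indepMH q w).comap (fun h : (i : ↥(Finset.Iic n)) → Ω => h ⟨n, Finset.mem_Iic.2 le_rfl⟩)
          (measurable_pi_apply _)) (E ∩ {y : ℕ → Ω | y 0 ≠ x₀}) := by
  set π : Measure Ω := q.withDensity fun y => ENNReal.ofReal (w y) with hπ
  have hA0 : 0 ≤ (w x₀)⁻¹ := inv_nonneg.mpr (hw0 x₀).le
  have hW : 1 ≤ w x₀ := one_le_of_mode (q := q) hmax
  have hρ0 : 0 ≤ 1 - (w x₀)⁻¹ * (1 - π.real {x₀}) := by
    have : (w x₀)⁻¹ * (1 - π.real {x₀}) ≤ 1 * 1 :=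
      mul_le_mul (inv_le_one_of_one_le₀ hW) (sub_le_self _ measureReal_nonneg) (sub_nonneg.2 measureReal_le_one)
        zero_le_one
    linarith
  rw [measure_iUnion (disjoint_thawAt x₀ fun _ => E) (fun t => measurableSet_thawAt x₀ t hE)]
  simp_rw [imh_chain_exitAt_inter_shift hw0 hmax _ hE]
  rw [ENNReal.tsum_mul_right, ← ENNReal.ofReal_tsum_of_nonneg (fun t => mul_nonneg hA0 (pow_nonneg hρ0 t))
    (hasSum_exit_weights (q := q) hw0 hmax hπ0).summable, (hasSum_exit_weights (q := q) hw0 hmax hπ0).tsum_eq]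

/-- **… in conditional form**: `P_{x₀}(⋃_t …)·(1 − π{x₀}) = P_π(E ∩ {X_0 ≠ x₀})` (real numbers). [ours] -/
theorem imh_chain_exitedRun_real [Fact (Measurable w)] (hw0 : ∀ y, 0 < w y) {x₀ : Ω} (hmax : ∀ y, w y ≤ w x₀)
    [IsProbabilityMeasure (q.withDensity fun y => ENNReal.ofReal (w y))]
    (hπ0 : (q.withDensity fun y => ENNReal.ofReal (w y)).real {x₀} < 1) {E : Set (ℕ → Ω)} (hE : MeasurableSet E) :
    (Kernel.trajMeasure (X := fun _ : ℕ => Ω) (Measure.dirac x₀)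
        (fun n : ℕ => (indepMH q w).comap (fun h : (i : ↥(Finset.Iic n)) → Ω => h ⟨n, Finset.mem_Iic.2 le_rfl⟩)
          (measurable_pi_apply _))).real (⋃ t : ℕ, {x : ℕ → Ω | (∀ i, i ≤ t → x i = x₀) ∧ x (t + 1) ≠ x₀ ∧ (fun n => x (t + 1 + n)) ∈ E}) *
        (1 - (q.withDensity fun y => ENNReal.ofReal (w y)).real {x₀}) =
      (Kernel.trajMeasure (X := fun _ : ℕ => Ω) (q.withDensity fun y => ENNReal.ofReal (w y))
        (fun n : ℕ => (indepMH q w).comap (fun h : (i : ↥(Finset.Iic n)) → Ω => h ⟨n, Finset.mem_Iic.2 le_rfl⟩)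
          (measurable_pi_apply _))).real (E ∩ {y : ℕ → Ω | y 0 ≠ x₀}) := by
  have h1π : 0 < 1 - (q.withDensity fun y => ENNReal.ofReal (w y)).real {x₀} := sub_pos.2 hπ0
  rw [measureReal_def, imh_chain_exitedRun hw0 hmax hπ0 hE, ENNReal.toReal_mul,
    ENNReal.toReal_ofReal (inv_nonneg.mpr h1π.le), ← measureReal_def]
  field_simp

/-- **THE CHAIN LEAVES THE MODE ALMOST SURELY** (`π{x₀} < 1`): `P_{x₀}(⋃_t {X_0 = … = X_t = x₀, X_{t+1} ≠ x₀}) = 1`.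
[ours] -/
theorem imh_chain_exits [Fact (Measurable w)] (hw0 : ∀ y, 0 < w y) {x₀ : Ω} (hmax : ∀ y, w y ≤ w x₀)
    [IsProbabilityMeasure (q.withDensity fun y => ENNReal.ofReal (w y))]
    (hπ0 : (q.withDensity fun y => ENNReal.ofReal (w y)).real {x₀} < 1) :
    Kernel.trajMeasure (X := fun _ : ℕ => Ω) (Measure.dirac x₀)
        (fun n : ℕ => (indepMH q w).comap (fun h : (i : ↥(Finset.Iic n)) → Ω => h ⟨n, Finset.mem_Iic.2 le_rfl⟩)
          (measurable_pi_apply _)) (⋃ t : ℕ, {x : ℕ → Ω | (∀ i, i ≤ t → x i = x₀) ∧ x (t + 1) ≠ x₀}) = 1 := by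
  set π : Measure Ω := q.withDensity fun y => ENNReal.ofReal (w y) with hπ
  have h1π : 0 < 1 - π.real {x₀} := sub_pos.2 hπ0
  have h := imh_chain_exitedRun (q := q) hw0 hmax hπ0 MeasurableSet.univ (x₀ := x₀)
  simp only [Set.mem_univ, and_true, Set.univ_inter] at h
  have hc : Kernel.trajMeasure (X := fun _ : ℕ => Ω) (q.withDensity fun y => ENNReal.ofReal (w y))
        (fun n : ℕ => (indepMH q w).comap (fun h : (i : ↥(Finset.Iic n)) → Ω => h ⟨n, Finset.mem_Iic.2 le_rfl⟩)
          (measurable_pi_apply _)) {y : ℕ → Ω | y 0 ≠ x₀} = ENNReal.ofReal (1 - π.real {x₀}) := by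
    rw [show {y : ℕ → Ω | y 0 ≠ x₀} = (fun x : ℕ → Ω => x 0) ⁻¹' ({x₀}ᶜ) by ext x; simp,
      ← Measure.map_apply (measurable_pi_apply 0) (measurableSet_singleton x₀).compl,
      chain_map_eval_zero (indepMH q w) π, ← ofReal_measureReal (measure_ne_top _ _),
      measureReal_compl (measurableSet_singleton x₀), probReal_univ]
  rw [h, hc, ← ENNReal.ofReal_mul (inv_nonneg.mpr h1π.le), inv_mul_cancel₀ h1π.ne', ENNReal.ofReal_one]

end Summit.Ventures.LatticeQCDFlow.Exactness

end
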